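import Summits.BirchSwinnertonDyer.Rank1Residual.P2.CongruentNumberPairsAtTwoPrimeSevenModEight
import Literature.NumberTheory.EllipticCurves.Tian2014.ClassSevenFamilyDescentProofs
import HarnessLib

/-!
# Sub-lane «bsd-p2»: TIAN'S CLASS-7 FAMILY AT `p = 2` — `BSD(E_n, 2)` for EVERY `n = p₀p₁⋯p_k`
# (`p₀ ≡ 7`, `pᵢ ≡ 1 (mod 8)`, odd graph), UNIFORMLY IN `k`, nothing per-curve displayed
# (p2-lead T-76 / T-78; inputs: p2-lit-1's `Tian2014/ClassSevenFamilyDescentProofs.lean`, p326865)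

HONEST FRAMING (sub-lane «bsd-p2», run/shared/lean/b2b/bsd-rank1-residual/p2/, verbatim in every
file): the target of record is the FULL Birch–Swinnerton-Dyer formula for EVERY analytic-rank `≤ 1`
`E/ℚ` at ALL primes INCLUDING `2`; the odd-prime class ledger is referee A's; the `2`-part is OPEN
(cells O1 = X5 ∖ CM and O12 = the CM corner) and under census by «bsd-p2». Census / instrument
output at `2` = EVIDENCE / conjecture items with held-out validation, NEVER a Literature fact;
certificates close PAIRS (one isogeny class, `p = 2`), never classes. This file asserts NO
arithmetic fact. THE FAMILY (Tian, Camb. J. Math. 2 (2014), Thm 1.3 / Lemma 5.1, class `m = n ≡ 7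
(mod 8)`): `n = p₀p₁⋯p_k`, distinct primes, `p₀ ≡ 7`, `pᵢ ≡ 1 (mod 8)` (`i ≥ 1`), and the graph `G(n)`
(edges `pᵢpⱼ` with `(pᵢ/pⱼ) = −1`) ODD, in Feng's kernel form `hG : ∀ v, A v = 0 → v = 0 ∨ v = 1`
(`A = legendreMatrix p`, the tree's currency). p2-lit-1 PROVED, uniformly in `k` (p326865): `s(n) = 1`
in the door's table shape (`card_ker_monskyTable_caseSeven`), `ρ(n) = 0` (`rhoIndex_eq_one_caseSeven`,
through p2-monsky-lit's descent bound), the odd first genus sum of Tian–Yuan–Zhang over `GenusField`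
(`odd_genusSum₁_caseSeven`, mod Rédei–Reichardt), Tian's condition (1.1) (`condition11_caseSeven`), and
the consequences `rankOneDatum_caseSeven` (TYZ: `r_an = 1`, `L′ = 2^{2k−1}𝓛²·Ω·Reg`, `𝓛` odd) and
`thm13_caseSeven` (Tian Thm 1.3: rank `1 = r_an`, `Ш` finite ODD). THIS FILE assembles the door (one
writer of `P2/`), TWO WAYS, each ONE theorem for every `k`:
* §1 ROUTE A — the sub-lane's closed door `bsdp_two_congruentNumberCurve_of_genus'` (p325791): `BSD(E_n, 2)`
  modulo {`h12` TYZ 2017 Thm 1.2, `hR` Rédei–Reichardt, `hGZK`, `hM` Monsky 1994};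
* §2 ROUTE B — Tian's own theorem: `thm13_caseSeven` (rank `= r_an`, `Ш` finite odd) + the TYZ datum
  + the GZK-FREE bridge `bsdp_iff_valuation_of_leadingLCoeff` (p312800): `BSD(E_n, 2)` modulo
  {`h12`, `h13` Tian 2014 Thm 1.3, `hR`} — NO Gross–Zagier–Kolyvagin, NO Monsky matrix fact; the
  valuation bookkeeping is `ord₂(2^{2k−1}𝓛²) = 0 + ord₂ 2^{2k+3} − 2·ord₂ 4` with torsion (p323719) and
  Tamagawa (p324736) by lit-1's theorems.
* §3 the `k = 1` member in symbol form (p2-lead T-78: "an explicit `k = 1` corollary is welcome"):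
  primes `p ≡ 1`, `q ≡ 7 (mod 8)` with `(p/q) = −1` (Monsky 1990 Cor 5.15 group (3)) — the graph on
  `{q, p}` is one edge, odd; `k = 0` is T-54 (`forall_bsdp_two_congruentNumberCurve_prime_seven_mod_eight`).
NOTHING per-curve is displayed in any statement. NEW IN THE TREE (T-72 / T-78 framing): rank one is in
print (Tian 2014 Thm 1.3); the `2`-part of BSD for this family is NOT a printed theorem — here it is a
kernel theorem modulo the displayed facts. A FAMILY of pairs in the OPEN cell `openO12`; not a class
closure. Nothing booked; no mark moved. Unit `b2b-bsdres-p2-typer` GEN 4 (T-76); NEW file. RE-KEY (append §4,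
T-81/T-84): the primed twins `…_caseSeven'`, `…_caseSeven_of_thm13'`, `forall_…'` are keyed to lit-1's
corrected fact `thm12_parity_of_scriptL'` (ERRATUM F-Σ2); §§1–3 carry the mis-stated one.

References: [Tian2014] Thm 1.3, Lemma 5.1, Lemma 5.3, (5.1); [TianYuanZhang2017] Thm 1.2, §1 (1.1);
[LiMa2008] Thm 0.4; [HeathBrown1994SelmerCongruentII] Appendix (Monsky); [FaulknerJames2007] Thm 1.2 (2);
[Monsky1990MockHeegner] Cor 5.15 (3); [Miller2011LMS] Def 1.1; HOME/p2/LEAD-OKS.md T-76, T-78, L1-45/46/47.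
-/

noncomputable section

open scoped Classical

open Matrix Finset WeierstrassCurve NumberField Literature.NumberTheory.EllipticCurves
  Literature.NumberTheory.EllipticCurves.Rank1Residual
  Literature.NumberTheory.EllipticCurves.Rank1Residual.Typed
  Literature.NumberTheory.EllipticCurves.HeathBrown1994
  Literature.NumberTheory.EllipticCurves.TianYuanZhang2017
  Literature.NumberTheory.EllipticCurves.Tian2014
  Literature.NumberTheory.QuadraticFields.RedeiReichardt

set_option autoImplicit false

namespace Summit.BirchSwinnertonDyer.Rank1Residual.P2

variable {k : ℕ} (p : Fin (k + 1) → ℕ)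

/-! ## §1 Route A: the closed door D-CN-6 on Tian's class-7 family (facts: TYZ 1.2, RR, GZK, Monsky 1994) -/

/-- **Tian's class-7 family through door D-CN-6 (every `k`, nothing displayed).** For distinct primes
`p₀ ≡ 7`, `pᵢ ≡ 1 (mod 8)` with odd graph (`hG`) and `n = ∏ pᵢ`: `BSD(E_n, 2)`, modulo the displayed
facts `h12` (TYZ Thm 1.2), `hR` (Rédei–Reichardt), `hGZK`, `hM` (Monsky 1994). The door's three
decidable inputs are lit-1's UNIFORM theorems: `card_ker_monskyTable_caseSeven` (`s(n) = 1`),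
`rhoIndex_eq_one_caseSeven` (`ρ(n) = 0`), `odd_genusSum₁_caseSeven` (`Σ₁` odd).
[cite: Tian2014, Lemma 5.1 and Lemma 5.3 / (5.1) (arXiv p. 28–29)] [cite: TianYuanZhang2017, Thm. 1.2]
[cite: Miller2011LMS, Def. 1.1 (arXiv:1010.2431 p. 3)] -/
theorem bsdp_two_congruentNumberCurve_caseSeven (h12 : thm12_parity_of_scriptL)
    (hR : redeiReichardt_fourTwoCard_classGroup) (hGZK : rank_eq_analyticRank_of_analyticRank_le_one)
    (hM : monsky_card_selmerGroup_two_odd) (hp : ∀ i, (p i).Prime) (hinj : Function.Injective p)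
    (h7 : p 0 % 8 = 7) (h1 : ∀ i, i ≠ 0 → p i % 8 = 1)
    (hG : ∀ v, legendreMatrix p *ᵥ v = 0 → v = 0 ∨ v = fun _ => 1) {n : ℕ} (hn : ∏ i, p i = n) :
    BSDp (congruentNumberCurve n) 2 :=
  bsdp_two_congruentNumberCurve_of_genus' p h12 hGZK hM hp (odd_of_caseSeven p h7 h1) hinj hn
    (Or.inr (hn ▸ prod_mod_eight_caseSeven p h7 h1))
    (fun i j => addLegendreSym (p j) (p i)) (fun i => addLegendreSym 2 (p i))
    (fun i => addLegendreSym (-2) (p i)) (fun _ _ => rfl) (fun _ => rfl) (fun _ => rfl)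
    (card_ker_monskyTable_caseSeven p h7 h1 hG) (rhoIndex_eq_one_caseSeven p hp hinj h7 h1 hG hn)
    (Or.inl (odd_genusSum₁_caseSeven p hR hp hinj h7 h1 hG hn))

/-! ## §2 Route B: Tian 2014 Thm 1.3 + the TYZ datum + the GZK-free bridge (facts: TYZ 1.2, Tian 1.3, RR) -/

/-- **Tian's class-7 family at `p = 2` from Tian's own theorems (every `k`, nothing displayed).** For
distinct primes `p₀ ≡ 7`, `pᵢ ≡ 1 (mod 8)` with odd graph and `n = ∏ pᵢ`: rank `E_n(ℚ) = 1 =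
ord_{s=1} L(E_n, s)`, `Ш(E_n)` is finite of odd order, AND `BSD(E_n, 2)` — modulo the displayed facts
`h12` (Tian–Yuan–Zhang 2017 Thm 1.2), `h13` (Tian 2014 Thm 1.3, condition (1.1) DISCHARGED by lit-1's
`condition11_caseSeven`), `hR` (Rédei–Reichardt). NO Gross–Zagier–Kolyvagin, NO Monsky matrix: rank and
the oddness of `#Ш` are Thm 1.3's conclusions (`thm13_caseSeven`); the analytic side is TYZ's datum
`L′(E_n,1) = 2^{2k−1}·𝓛²·Ω·Reg`, `𝓛` odd (`rankOneDatum_caseSeven`); the bridge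
`bsdp_iff_valuation_of_leadingLCoeff` reads `BSD₂ ⟺ 2k − 1 = ord₂ #Ш + ord₂ ∏c_ℓ − 2·ord₂ #tor =
0 + (2k + 3) − 4`, with `∏c_ℓ = 2^{2(k+1)+1}` and `#tor = 4` lit-1's theorems (p324736, p323719).
[cite: Tian2014, Thm. 1.3 (arXiv:1210.8231 p. 2, L5–L15) with Lemma 5.1] [cite: TianYuanZhang2017, Thm. 1.2 and §1 (1.1)]
[cite: LiMa2008, Thm. 0.4] [cite: Miller2011LMS, Def. 1.1 (arXiv:1010.2431 p. 3)] -/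
theorem bsdp_two_congruentNumberCurve_caseSeven_of_thm13 (h12 : thm12_parity_of_scriptL)
    (h13 : thm13_rank_one_and_sha_odd) (hR : redeiReichardt_fourTwoCard_classGroup)
    (hp : ∀ i, (p i).Prime) (hinj : Function.Injective p) (h7 : p 0 % 8 = 7)
    (h1 : ∀ i, i ≠ 0 → p i % 8 = 1) (hG : ∀ v, legendreMatrix p *ᵥ v = 0 → v = 0 ∨ v = fun _ => 1)
    {n : ℕ} (hn : ∏ i, p i = n) :
    (congruentNumberCurve n).mordellWeilRank = 1 ∧ (congruentNumberCurve n).analyticRank = 1 ∧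
      Finite (congruentNumberCurve n).sha ∧ Odd (Nat.card (congruentNumberCurve n).sha) ∧
      BSDp (congruentNumberCurve n) 2 := by
  have hsq : Squarefree n := hn ▸ squarefree_prod_of_injective p hp hinj
  haveI := isElliptic_congruentNumberCurve hsq.ne_zero
  haveI : Fact (Nat.Prime 2) := ⟨Nat.prime_two⟩
  obtain ⟨hrk, hr, hfin, hodd⟩ := thm13_caseSeven p h13 hR hp hinj h7 h1 hG hn
  haveI := hfin
  obtain ⟨Lz, hLodd, hr1, hderiv⟩ := rankOneDatum_caseSeven p h12 hR hp hinj h7 h1 hG hn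
  refine ⟨hrk, hr, hfin, hodd, ?_⟩
  have hL : (congruentNumberCurve n).leadingLCoeff =
      (((2 : ℚ) ^ (2 * (k : ℤ) - 1) * (Lz : ℚ) ^ 2 : ℚ) : ℂ) *
        ((congruentNumberCurve n).realPeriodRat : ℂ) * ((congruentNumberCurve n).regulator : ℂ) := by
    rw [(leadingLCoeff_eq_deriv_of_analyticRank_eq_one hr1).1, hderiv]; push_cast; ring
  have hx0 : (2 : ℚ) ^ (2 * (k : ℤ) - 1) * (Lz : ℚ) ^ 2 ≠ 0 := by
    have hL0' : Lz ≠ 0 := fun h => by simp [h] at hLodd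
    have hL0 : (Lz : ℚ) ≠ 0 := by exact_mod_cast hL0'
    exact mul_ne_zero (zpow_ne_zero _ two_ne_zero) (pow_ne_zero _ hL0)
  rw [bsdp_iff_valuation_of_leadingLCoeff (congruentNumberCurve n) 2 (hrk.trans hr.symm) hx0 hL,
    padicValRat_two_zpow_mul_sq hLodd, padicValNat.eq_zero_of_not_dvd hodd.not_two_dvd_nat,
    tamagawaProduct_congruentNumberCurve_prod p hp (odd_of_caseSeven p h7 h1) hinj hn,
    torsionOrder_congruentNumberCurve hsq, padicValNat.prime_pow,
    show (4 : ℕ) = 2 ^ 2 by norm_num, padicValNat.prime_pow]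
  push_cast
  ring

/-- **The family, quantified** (route B): for every `k`, every injective tuple of primes
`(p₀, …, p_k)` with `p₀ ≡ 7`, `pᵢ ≡ 1 (mod 8)` and odd graph, `BSD(E_{p₀⋯p_k}, 2)` — modulo
{TYZ Thm 1.2, Tian Thm 1.3, Rédei–Reichardt}, nothing per-curve displayed.
[cite: Tian2014, Thm. 1.3 with Lemma 5.1] [cite: TianYuanZhang2017, Thm. 1.2] [cite: Miller2011LMS, Def. 1.1] -/
theorem forall_bsdp_two_congruentNumberCurve_caseSeven (h12 : thm12_parity_of_scriptL)
    (h13 : thm13_rank_one_and_sha_odd) (hR : redeiReichardt_fourTwoCard_classGroup) :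
    ∀ (k : ℕ) (p : Fin (k + 1) → ℕ), (∀ i, (p i).Prime) → Function.Injective p → p 0 % 8 = 7 →
      (∀ i, i ≠ 0 → p i % 8 = 1) → (∀ v, legendreMatrix p *ᵥ v = 0 → v = 0 ∨ v = fun _ => 1) →
      BSDp (congruentNumberCurve (∏ i, p i)) 2 :=
  fun _ p hp hinj h7 h1 hG =>
    (bsdp_two_congruentNumberCurve_caseSeven_of_thm13 p h12 h13 hR hp hinj h7 h1 hG rfl).2.2.2.2

/-! ## §3 The `k = 1` member in symbol form: `n = p·q`, `p ≡ 1`, `q ≡ 7 (mod 8)`, `(p/q) = −1` -/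

/-- For primes `p ≡ 1`, `q ≡ 7 (mod 8)` with `(p/q) = −1` the graph `G(pq)` is a single edge: Monsky's
`A = legendreMatrix (q, p) = (1 1; 1 1)` (`(p/q) = −1` and, by quadratic reciprocity for `p ≡ 1 (mod 4)`,
`(q/p) = −1`), whose kernel is `{0, (1,1)}` — Tian's odd-graph condition at `k = 1`.
[cite: Tian2014, Lemma 5.1 (the graph G)] [cite: IrelandRosen1990, Ch. 5 §2 Thm. 1 (quadratic reciprocity)] -/
theorem oddGraph_one_seven {p q : ℕ} (hq : q.Prime) (h1 : p % 8 = 1) (h7 : q % 8 = 7)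
    (hJ : jacobiSym p q = -1) :
    ∀ v, legendreMatrix ![q, p] *ᵥ v = 0 → v = 0 ∨ v = fun _ => 1 := by
  have hqp : jacobiSym q p = -1 := by
    rw [jacobiSym.quadratic_reciprocity_one_mod_four' (hq.odd_of_ne_two (fun h => by omega)) (by omega), hJ]
  have a01 : addLegendreSym (p : ℤ) q = 1 := addLegendreSym_of_eq_neg_one (by exact_mod_cast hJ)
  have a10 : addLegendreSym (q : ℤ) p = 1 := addLegendreSym_of_eq_neg_one (by exact_mod_cast hqp)
  have e : legendreMatrix ![q, p] = !![1, 1; 1, 1] := by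
    have e0 : (Finset.univ : Finset (Fin 2)).erase 0 = {1} := by decide
    have e1 : (Finset.univ : Finset (Fin 2)).erase 1 = {0} := by decide
    ext i j
    simp only [legendreMatrix, Matrix.of_apply]
    fin_cases i <;> fin_cases j <;> simp [e0, e1, a01, a10]
  rw [e]
  decide

/-- **`BSD(E_{pq}, 2)` for ALL primes `p ≡ 1`, `q ≡ 7 (mod 8)` with `(p/q) = −1`** (Tian's class-7 family
at `k = 1`; Monsky 1990 Cor 5.15 group (3) `p₁p₇`): route B at the tuple `(q, p)` — modulo
{TYZ Thm 1.2, Tian Thm 1.3, Rédei–Reichardt}, nothing per-curve displayed.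
[cite: Tian2014, Thm. 1.3 with Lemma 5.1] [cite: TianYuanZhang2017, Thm. 1.2]
[cite: Monsky1990MockHeegner, Cor. 5.15 (3) (p. 66)] [cite: Miller2011LMS, Def. 1.1] -/
theorem forall_bsdp_two_congruentNumberCurve_one_seven (h12 : thm12_parity_of_scriptL)
    (h13 : thm13_rank_one_and_sha_odd) (hR : redeiReichardt_fourTwoCard_classGroup) :
    ∀ p q : ℕ, p.Prime → q.Prime → p % 8 = 1 → q % 8 = 7 → jacobiSym p q = -1 →
      BSDp (congruentNumberCurve (p * q)) 2 := by
  intro p q hp hq h1 h7 hJ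
  have hne : q ≠ p := fun h => by omega
  have hinj : Function.Injective (![q, p] : Fin 2 → ℕ) := by
    intro i j h
    fin_cases i <;> fin_cases j <;> simp_all [hne.symm]
  exact (bsdp_two_congruentNumberCurve_caseSeven_of_thm13 (k := 1) ![q, p] h12 h13 hR
    (fun i => by fin_cases i <;> assumption) hinj h7
    (fun i hi => by fin_cases i <;> simp_all) (oddGraph_one_seven hq h1 h7 hJ)
    (by simp [Fin.prod_univ_two, mul_comm])).2.2.2.2


/-! ## §4 RE-KEY (APPEND-ONLY, p2-typer GEN 4, ruling T-81 / T-84): the family keyed to Thm 1.2 AS PRINTED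

ERRATUM F-Σ2: the GEN-1 fact `thm12_parity_of_scriptL` is MIS-STATED (its `Σ₂` omits the `ℓ = 0` term);
§§1–3 above are KEPT but should no longer be consumed.  The family feeds `Σ₁`
(`odd_genusSum₁_caseSeven`), so the twins below only exchange the fact for lit-1's corrected
`thm12_parity_of_scriptL'` (datum `rankOneDatum_of_index_eq_one'`); route A goes through the re-keyed
closed door `bsdp_two_congruentNumberCurve_of_genus''`. -/

/-- **Route A, keyed to Thm 1.2 AS PRINTED** (twin of `bsdp_two_congruentNumberCurve_caseSeven`).
[cite: Tian2014, Lemma 5.1 and Lemma 5.3 / (5.1) (arXiv p. 28–29)] [cite: TianYuanZhang2017, Thm. 1.2]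
[cite: Miller2011LMS, Def. 1.1 (arXiv:1010.2431 p. 3)] -/
theorem bsdp_two_congruentNumberCurve_caseSeven' (h12 : thm12_parity_of_scriptL')
    (hR : redeiReichardt_fourTwoCard_classGroup) (hGZK : rank_eq_analyticRank_of_analyticRank_le_one)
    (hM : monsky_card_selmerGroup_two_odd) (hp : ∀ i, (p i).Prime) (hinj : Function.Injective p)
    (h7 : p 0 % 8 = 7) (h1 : ∀ i, i ≠ 0 → p i % 8 = 1)
    (hG : ∀ v, legendreMatrix p *ᵥ v = 0 → v = 0 ∨ v = fun _ => 1) {n : ℕ} (hn : ∏ i, p i = n) :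
    BSDp (congruentNumberCurve n) 2 :=
  bsdp_two_congruentNumberCurve_of_genus'' p h12 hGZK hM hp (odd_of_caseSeven p h7 h1) hinj hn
    (Or.inr (hn ▸ prod_mod_eight_caseSeven p h7 h1))
    (fun i j => addLegendreSym (p j) (p i)) (fun i => addLegendreSym 2 (p i))
    (fun i => addLegendreSym (-2) (p i)) (fun _ _ => rfl) (fun _ => rfl) (fun _ => rfl)
    (card_ker_monskyTable_caseSeven p h7 h1 hG) (rhoIndex_eq_one_caseSeven p hp hinj h7 h1 hG hn)
    (Or.inl (odd_genusSum₁_caseSeven p hR hp hinj h7 h1 hG hn))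

/-- **Route B, keyed to Thm 1.2 AS PRINTED** (twin of `bsdp_two_congruentNumberCurve_caseSeven_of_thm13`):
rank `E_n(ℚ) = 1 = ord_{s=1} L(E_n, s)`, `Ш(E_n)` finite of odd order, and `BSD(E_n, 2)` on Tian's
class-7 family — modulo `h12` (TYZ Thm 1.2 as printed), `h13` (Tian 2014 Thm 1.3), `hR`; no GZK, no
Monsky fact. The TYZ datum is taken from lit-1's `rankOneDatum_of_index_eq_one'` directly (inputs
`rhoIndex_eq_one_caseSeven`, `odd_genusSum₁_caseSeven`, `twoExponent_caseSeven`).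
[cite: Tian2014, Thm. 1.3 (arXiv:1210.8231 p. 2, L5–L15) with Lemma 5.1] [cite: TianYuanZhang2017, Thm. 1.2 and §1 (1.1)]
[cite: LiMa2008, Thm. 0.4] [cite: Miller2011LMS, Def. 1.1 (arXiv:1010.2431 p. 3)] -/
theorem bsdp_two_congruentNumberCurve_caseSeven_of_thm13' (h12 : thm12_parity_of_scriptL')
    (h13 : thm13_rank_one_and_sha_odd) (hR : redeiReichardt_fourTwoCard_classGroup)
    (hp : ∀ i, (p i).Prime) (hinj : Function.Injective p) (h7 : p 0 % 8 = 7)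
    (h1 : ∀ i, i ≠ 0 → p i % 8 = 1) (hG : ∀ v, legendreMatrix p *ᵥ v = 0 → v = 0 ∨ v = fun _ => 1)
    {n : ℕ} (hn : ∏ i, p i = n) :
    (congruentNumberCurve n).mordellWeilRank = 1 ∧ (congruentNumberCurve n).analyticRank = 1 ∧
      Finite (congruentNumberCurve n).sha ∧ Odd (Nat.card (congruentNumberCurve n).sha) ∧
      BSDp (congruentNumberCurve n) 2 := by
  have hsq : Squarefree n := hn ▸ squarefree_prod_of_injective p hp hinj
  haveI := isElliptic_congruentNumberCurve hsq.ne_zero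
  haveI : Fact (Nat.Prime 2) := ⟨Nat.prime_two⟩
  obtain ⟨hrk, hr, hfin, hodd⟩ := thm13_caseSeven p h13 hR hp hinj h7 h1 hG hn
  haveI := hfin
  have h8 : n % 8 = 7 := hn ▸ prod_mod_eight_caseSeven p h7 h1
  have hexp : twoExponent n = 2 * (k : ℤ) - 1 := hn ▸ twoExponent_caseSeven p hp hinj h7 h1
  obtain ⟨Lz, hLodd, hr1, hderiv⟩ := rankOneDatum_of_index_eq_one' h12 hsq (Or.inr h8)
    (rhoIndex_eq_one_caseSeven p hp hinj h7 h1 hG hn) GenusField (isGenusFieldFamily_genusField n)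
    (Or.inl (odd_genusSum₁_caseSeven p hR hp hinj h7 h1 hG hn))
  refine ⟨hrk, hr, hfin, hodd, ?_⟩
  have hL : (congruentNumberCurve n).leadingLCoeff =
      (((2 : ℚ) ^ (2 * (k : ℤ) - 1) * (Lz : ℚ) ^ 2 : ℚ) : ℂ) *
        ((congruentNumberCurve n).realPeriodRat : ℂ) * ((congruentNumberCurve n).regulator : ℂ) := by
    rw [(leadingLCoeff_eq_deriv_of_analyticRank_eq_one hr1).1, hderiv, hexp]; push_cast; ring
  have hx0 : (2 : ℚ) ^ (2 * (k : ℤ) - 1) * (Lz : ℚ) ^ 2 ≠ 0 := by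
    have hL0' : Lz ≠ 0 := fun h => by simp [h] at hLodd
    have hL0 : (Lz : ℚ) ≠ 0 := by exact_mod_cast hL0'
    exact mul_ne_zero (zpow_ne_zero _ two_ne_zero) (pow_ne_zero _ hL0)
  rw [bsdp_iff_valuation_of_leadingLCoeff (congruentNumberCurve n) 2 (hrk.trans hr.symm) hx0 hL,
    padicValRat_two_zpow_mul_sq hLodd, padicValNat.eq_zero_of_not_dvd hodd.not_two_dvd_nat,
    tamagawaProduct_congruentNumberCurve_prod p hp (odd_of_caseSeven p h7 h1) hinj hn,
    torsionOrder_congruentNumberCurve hsq, padicValNat.prime_pow,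
    show (4 : ℕ) = 2 ^ 2 by norm_num, padicValNat.prime_pow]
  push_cast
  ring

/-- **The family, quantified, keyed to Thm 1.2 AS PRINTED** (twin of
`forall_bsdp_two_congruentNumberCurve_caseSeven`): modulo {TYZ Thm 1.2 (as printed), Tian Thm 1.3,
Rédei–Reichardt}, nothing per-curve displayed. [cite: Tian2014, Thm. 1.3 with Lemma 5.1] [cite: TianYuanZhang2017, Thm. 1.2] [cite: Miller2011LMS, Def. 1.1] -/
theorem forall_bsdp_two_congruentNumberCurve_caseSeven' (h12 : thm12_parity_of_scriptL')
    (h13 : thm13_rank_one_and_sha_odd) (hR : redeiReichardt_fourTwoCard_classGroup) :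
    ∀ (k : ℕ) (p : Fin (k + 1) → ℕ), (∀ i, (p i).Prime) → Function.Injective p → p 0 % 8 = 7 →
      (∀ i, i ≠ 0 → p i % 8 = 1) → (∀ v, legendreMatrix p *ᵥ v = 0 → v = 0 ∨ v = fun _ => 1) →
      BSDp (congruentNumberCurve (∏ i, p i)) 2 :=
  fun _ p hp hinj h7 h1 hG =>
    (bsdp_two_congruentNumberCurve_caseSeven_of_thm13' p h12 h13 hR hp hinj h7 h1 hG rfl).2.2.2.2

/-- **`BSD(E_{pq}, 2)` for ALL primes `p ≡ 1`, `q ≡ 7 (mod 8)` with `(p/q) = −1`, keyed to Thm 1.2 AS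
PRINTED** (twin of `forall_bsdp_two_congruentNumberCurve_one_seven`). [cite: Tian2014, Thm. 1.3 with Lemma 5.1]
[cite: TianYuanZhang2017, Thm. 1.2] [cite: Monsky1990MockHeegner, Cor. 5.15 (3) (p. 66)] [cite: Miller2011LMS, Def. 1.1] -/
theorem forall_bsdp_two_congruentNumberCurve_one_seven' (h12 : thm12_parity_of_scriptL')
    (h13 : thm13_rank_one_and_sha_odd) (hR : redeiReichardt_fourTwoCard_classGroup) :
    ∀ p q : ℕ, p.Prime → q.Prime → p % 8 = 1 → q % 8 = 7 → jacobiSym p q = -1 →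
      BSDp (congruentNumberCurve (p * q)) 2 := by
  intro p q hp hq h1 h7 hJ
  have hne : q ≠ p := fun h => by omega
  have hinj : Function.Injective (![q, p] : Fin 2 → ℕ) := by
    intro i j h
    fin_cases i <;> fin_cases j <;> simp_all [hne.symm]
  exact (bsdp_two_congruentNumberCurve_caseSeven_of_thm13' (k := 1) ![q, p] h12 h13 hR
    (fun i => by fin_cases i <;> assumption) hinj h7
    (fun i hi => by fin_cases i <;> simp_all) (oddGraph_one_seven hq h1 h7 hJ)
    (by simp [Fin.prod_univ_two, mul_comm])).2.2.2.2

end Summit.BirchSwinnertonDyer.Rank1Residual.P2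

end
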